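import Literature.NumberTheory.LFunctions.Zhang2022.RepairGapLemma101RangesPremise
import Literature.NumberTheory.LFunctions.Zhang2022.RepairGapPartIIIDoors
import Literature.NumberTheory.LFunctions.Zhang2022.Section10Lemma101
import HarnessLib

/-!
# Zhang (2022), rescue GAP/BED (D-0124 (3)(4)): LEMMA 10.1 (node `Skeleton.Lemma101 c′`, cone C24 of `theorem1_of_leaves`)
# with its guard `AssumptionA` replaced by `‖L(1,χ)‖ ≤ 𝓛⁻¹⁵` — the whole leaf closes at (A)-exponent 15

Topic `Literature/NumberTheory/LFunctions/Zhang2022` (Landau–Siegel audit tree; verdict-neutral).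
Y. Zhang, *Discrete mean estimates and the Landau–Siegel zero*, arXiv:2211.02515v1 (2022)
[Zhang2022LandauSiegel] — **an unrefereed manuscript under adjudication; nothing in this file asserts or
denies its Theorems 1–2, and nothing here is a claim about Landau–Siegel zeros. The programme SEARCHES and
TYPES; no claim about Landau–Siegel zeros, Theorems 1–2 of arXiv:2211.02515 or a repaired Margin232 until a
kernel theorem says so.**

Third of three files. `range_four_pow15` (the three edge windows, `O(𝓛⁻⁷)`, via `norm_riesz_le_pow15`) and the assembled
leaf: **`lemma101_pow15 : 0 ≤ c′ → (body of Skeleton.Lemma101 c′ with AssumptionA D χ ↦ ‖L(1,χ)‖ ≤ 𝓛⁻¹⁵)`** — the tree's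
`Lemma101.lemma101_holds` verbatim (same `c = 1/2`, `C = max 20 (max (1500·C82 K) (2000·C_U))`, threshold
`⌈exp(1024 + Kπ)⌉`, `K = 3 + 5c′`), range (i) being the tree's (A)-free `range_one`. Hence Lemma 10.1 under
`Repair.Bed.AssumptionAWith E` for every real `E ≥ 15` (`lemma101_of_assumptionAWith`); at `E = 2022` the transfer lemma
`Repair.Gap.forAllLarge_assumptionA_of_pow15` returns exactly `Skeleton.lemma101_holds` (not restated). READING (GAP G-31,
as-typed): every (A)-use in the Lemma 10.1 leaf is either the Lemma 8.2 core (E ≥ 15 via the 5.8 door) or the crude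
`‖L(1,χ)‖ ≤ 𝓛^{−1.1}` of the short means; the leaf is kernel at E = 15 with the printed constants. Theorems only; no
definition, no named fact; nothing about (A) itself.

## References

* Y. Zhang, arXiv:2211.02515v1 (2022), §10 Lemma 10.1 (pp. 19–20), (10.3), (10.4), (10.7). [cite: Zhang2022LandauSiegel, §10 Lemma 10.1]
-/

noncomputable section

open Complex Real

namespace Literature.NumberTheory.LFunctions.Zhang2022.Lemma101

open Literature.NumberTheory.LFunctions.Zhang2022.Skeleton
open Literature.NumberTheory.LFunctions.Zhang2022.Lemma82 (twist C82)
open Literature.NumberTheory.LFunctions.Zhang2022.Repair.Bed (AssumptionAWith)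

variable {D : ℕ} (χ : DirichletCharacter ℂ D)

/-- **The three edge windows under the minimum premise** (twin of `Lemma101.range_four`, `O(𝓛⁻⁷)` with the same
constant): `‖L(1,χ)‖ ≤ 𝓛⁻¹⁵` in place of (A), via `norm_riesz_le_pow15`. [cite: Zhang2022LandauSiegel, §10 Lemma 10.1] -/
theorem range_four_pow15 [NeZero D] (hprim : χ.IsPrimitive) {c' : ℝ} (hc' : 0 ≤ c')
    (hL : 1024 + (3 + 5 * c') * π ≤ Real.log D) (h15 : ‖χ.LFunction 1‖ ≤ 1 / Real.log D ^ 15)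
    {j : ℕ} (hj : j ∈ ({1, 2, 3} : Finset ℕ)) {y : ℝ} (hy : bigP D ^ (0.5 : ℝ) / bigT D < y) :
    ‖frakv1 c' χ j y‖ ≤ 2000 * (5 + 4 * (3 + 5 * c') * π +
      4 * Real.exp (9 / 2) * (1 + (3 + 5 * c') * π) + C82 (3 + 5 * c')) / Real.log D ^ 7 := by
  obtain ⟨hlogP, hT, hPa⟩ := params D
  obtain ⟨hL200, hL3, hP1, hδre, hδn, hK4, hT9⟩ := setting (D := D) hc' hL hj
  have hK0 : 0 ≤ 3 + 5 * c' := by positivity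
  set L : ℝ := Real.log D with hLdef
  set β : ℂ := betaJ c' D j with hβdef
  set CU : ℝ := 5 + 4 * (3 + 5 * c') * π + 4 * Real.exp (9 / 2) * (1 + (3 + 5 * c') * π) +
    C82 (3 + 5 * c') with hCU
  have hL0 : 0 < L := by linarith
  have hP0 : 0 < bigP D := by linarith
  have hPa0 : ∀ a : ℝ, 0 < bigP D ^ a := fun a => Real.rpow_pos_of_pos hP0 a
  have hT0 : 0 < bigT D := by rw [hT]; exact Real.exp_pos _
  have hy1 : 1 ≤ y := by
    refine le_trans ?_ hy.le
    rw [le_div_iff₀ hT0, one_mul, hT, hPa]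
    exact Real.exp_le_exp.mpr (by linarith)
  have hy0 : 0 < y := by linarith
  have hXP : ∀ a : ℝ, a ≤ 1 → 0 < bigP D ^ a / y ∧ bigP D ^ a / y ≤ Real.exp (L ^ 9) := by
    intro a ha
    refine ⟨by positivity, ?_⟩
    calc bigP D ^ a / y ≤ bigP D ^ a := div_le_self (hPa0 a).le hy1
      _ = Real.exp (a * L ^ 9) := hPa a
      _ ≤ Real.exp (L ^ 9) := Real.exp_le_exp.mpr (by nlinarith [pow_pos hL0 9])
  have hb : ∀ a : ℝ, a ≤ 1 → ‖∑ m ∈ Finset.Ioc 0 ⌊bigP D ^ a / y⌋₊, twist χ (-β) m *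
      (Real.log (bigP D ^ a / y / m) : ℂ)‖ ≤ CU * L ^ 2 := fun a ha =>
    norm_riesz_le_pow15 χ hprim hK0 hL200 h15 hδre hδn (hXP a ha).1 (hXP a ha).2
  rw [frakv1_eq χ c' j hy1 hP1, norm_mul, Complex.norm_real,
    Real.norm_of_nonneg (by rw [hlogP]; positivity), hlogP]
  set A1 := ∑ m ∈ Finset.Ioc 0 ⌊bigP D ^ (0.504 : ℝ) / y⌋₊, twist χ (-β) m *
    (Real.log (bigP D ^ (0.504 : ℝ) / y / m) : ℂ) with hA1def
  set A2 := ∑ m ∈ Finset.Ioc 0 ⌊bigP D ^ (0.502 : ℝ) / y⌋₊, twist χ (-β) m *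
    (Real.log (bigP D ^ (0.502 : ℝ) / y / m) : ℂ) with hA2def
  set A3 := ∑ m ∈ Finset.Ioc 0 ⌊bigP D ^ (0.5 : ℝ) / y⌋₊, twist χ (-β) m *
    (Real.log (bigP D ^ (0.5 : ℝ) / y / m) : ℂ) with hA3def
  have e1 : ‖A1‖ ≤ CU * L ^ 2 := hb _ (by norm_num)
  have e2 : ‖2 * A2‖ ≤ 2 * (CU * L ^ 2) := by
    rw [norm_mul, Complex.norm_two]
    exact mul_le_mul_of_nonneg_left (hb _ (by norm_num)) zero_le_two
  have e3 : ‖A3‖ ≤ CU * L ^ 2 := hb _ (by norm_num)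
  have h3 : ‖A1 - 2 * A2 + A3‖ ≤ 4 * (CU * L ^ 2) := by
    calc ‖A1 - 2 * A2 + A3‖ ≤ ‖A1 - 2 * A2‖ + ‖A3‖ := norm_add_le _ _
      _ ≤ (‖A1‖ + ‖2 * A2‖) + ‖A3‖ := add_le_add (norm_sub_le _ _) le_rfl
      _ ≤ (CU * L ^ 2 + 2 * (CU * L ^ 2)) + CU * L ^ 2 := add_le_add (add_le_add e1 e2) e3
      _ = 4 * (CU * L ^ 2) := by ring
  calc 500 / L ^ 9 * ‖A1 - 2 * A2 + A3‖ ≤ 500 / L ^ 9 * (4 * (CU * L ^ 2)) :=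
        mul_le_mul_of_nonneg_left h3 (by positivity)
    _ = 2000 * CU / L ^ 7 := by
        field_simp
        ring

/-- **LEMMA 10.1 UNDER THE MINIMUM PREMISE**: for every `c′ ≥ 0`, the body of the leaf `Skeleton.Lemma101 c′` with its
guard `AssumptionA D χ` replaced by `‖L(1,χ)‖ ≤ 𝓛⁻¹⁵` — the four ranges (i)–(iv) of `𝔳₁ⱼ(y)` with the printed main terms
(10.3)/(10.4) — HOLDS (tree proof of `Lemma101.lemma101_holds` verbatim over `range_one` (A-free), `range_two_pow15`,
`range_three_pow15`, `range_four_pow15`). [cite: Zhang2022LandauSiegel, §10 Lemma 10.1] -/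
theorem lemma101_pow15 {c' : ℝ} (hc' : 0 ≤ c') :
    ∃ c : ℝ, 0 < c ∧ ∃ C : ℝ, ForAllLarge fun D _ χ => ‖χ.LFunction 1‖ ≤ 1 / Real.log D ^ 15 →
    ∀ j ∈ ({1, 2, 3} : Finset ℕ), ∀ y : ℝ,
      (1 ≤ y → y ≤ bigP D ^ (0.5 : ℝ) / bigT D → ‖frakv1 c' χ j y‖ ≤ C * bigT D ^ (-c)) ∧
      (bigP D ^ (0.5 : ℝ) < y → y ≤ bigP D ^ (0.502 : ℝ) / bigT D →
        ‖frakv1 c' χ j y - 500 * deriv χ.LFunction 1 / Real.log (bigP D) *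
          (-1 - betaJ c' D j * (Real.log (y / bigP D ^ (0.5 : ℝ)) : ℂ))‖ ≤ C * (ell D ^ 15)⁻¹) ∧
      (bigP D ^ (0.502 : ℝ) < y → y ≤ bigP D ^ (0.504 : ℝ) / bigT D →
        ‖frakv1 c' χ j y - 500 * deriv χ.LFunction 1 / Real.log (bigP D) *
          (1 - betaJ c' D j * (Real.log (bigP D ^ (0.504 : ℝ) / y) : ℂ))‖ ≤ C * (ell D ^ 15)⁻¹) ∧
      ((bigP D ^ (0.5 : ℝ) / bigT D < y ∧ y ≤ bigP D ^ (0.5 : ℝ)) ∨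
          (bigP D ^ (0.502 : ℝ) / bigT D < y ∧ y ≤ bigP D ^ (0.502 : ℝ)) ∨
          (bigP D ^ (0.504 : ℝ) / bigT D < y ∧ y < bigP D ^ (0.504 : ℝ)) →
        ‖frakv1 c' χ j y‖ ≤ C * (ell D ^ 7)⁻¹) := by
  set K : ℝ := 3 + 5 * c' with hK
  set CU : ℝ := 5 + 4 * K * π + 4 * Real.exp (9 / 2) * (1 + K * π) + C82 K with hCU
  have hπ := Real.pi_pos
  have hK0 : 0 ≤ K := by positivity
  have hC82 := C82_nonneg hK0
  have hCU0 : 0 ≤ CU := by positivity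
  refine ⟨1 / 2, by norm_num, max 20 (max (1500 * C82 K) (2000 * CU)),
    ⌈Real.exp (1024 + K * π)⌉₊, fun D _ χ hD hq hp h15 j hj y => ?_⟩
  have hexp : Real.exp (1024 + K * π) ≤ D := le_trans (Nat.le_ceil _) (by exact_mod_cast hD)
  have hL : 1024 + (3 + 5 * c') * π ≤ Real.log D :=
    (Real.le_log_iff_exp_le (lt_of_lt_of_le (Real.exp_pos _) hexp)).mpr hexp
  have hL0 : 0 < Real.log D := by nlinarith
  have hell : ell D = Real.log D := rfl
  have hC1 : (20 : ℝ) ≤ max 20 (max (1500 * C82 K) (2000 * CU)) := le_max_left _ _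
  have hC2 : 1500 * C82 K ≤ max 20 (max (1500 * C82 K) (2000 * CU)) :=
    (le_max_left _ _).trans (le_max_right _ _)
  have hC3 : 2000 * CU ≤ max 20 (max (1500 * C82 K) (2000 * CU)) :=
    (le_max_right _ _).trans (le_max_right _ _)
  refine ⟨fun h1 h2 => ?_, fun h1 h2 => ?_, fun h1 h2 => ?_, fun h => ?_⟩
  · refine (range_one χ hp hc' hL hj h1 h2).trans ?_
    have : 0 < bigT D ^ (-(1 / 2 : ℝ)) := Real.rpow_pos_of_pos (by rw [(params D).2.1]; exact Real.exp_pos _) _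
    exact mul_le_mul_of_nonneg_right hC1 this.le
  · refine (range_two_pow15 χ hp hc' hL h15 hj h1 h2).trans ?_
    rw [hell, div_eq_mul_inv]
    exact mul_le_mul_of_nonneg_right hC2 (by positivity)
  · refine (range_three_pow15 χ hp hc' hL h15 hj h1 h2).trans ?_
    rw [hell, div_eq_mul_inv]
    refine mul_le_mul_of_nonneg_right (le_trans ?_ hC2) (by positivity)
    nlinarith
  · have hy : bigP D ^ (0.5 : ℝ) / bigT D < y := by
      obtain ⟨hlogP, hT, hPa⟩ := params D
      have hT0 : 0 < bigT D := by rw [hT]; exact Real.exp_pos _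
      have hmono : ∀ a b : ℝ, a ≤ b → bigP D ^ a / bigT D ≤ bigP D ^ b / bigT D := by
        intro a b hab
        refine div_le_div_of_nonneg_right ?_ hT0.le
        rw [hPa, hPa]
        exact Real.exp_le_exp.mpr (mul_le_mul_of_nonneg_right hab (by positivity))
      rcases h with ⟨h1, -⟩ | ⟨h1, -⟩ | ⟨h1, -⟩
      · exact h1
      · exact lt_of_le_of_lt (hmono _ _ (by norm_num)) h1
      · exact lt_of_le_of_lt (hmono _ _ (by norm_num)) h1
    refine (range_four_pow15 χ hp hc' hL h15 hj hy).trans ?_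
    rw [hell, div_eq_mul_inv]
    exact mul_le_mul_of_nonneg_right hC3 (by positivity)

/-- **Lemma 10.1 from Assumption (A) with ANY exponent `E ≥ 15`** (`Repair.Bed.AssumptionAWith E`; printed `E = 2022`,
under which the transfer lemma returns the tree leaf `Skeleton.lemma101_holds`). [cite: Zhang2022LandauSiegel, §10 Lemma 10.1] -/
theorem lemma101_of_assumptionAWith {c' : ℝ} (hc' : 0 ≤ c') {E : ℝ} (hE : 15 ≤ E) :
    ∃ c : ℝ, 0 < c ∧ ∃ C : ℝ, ForAllLarge fun D _ χ => AssumptionAWith E D χ →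
    ∀ j ∈ ({1, 2, 3} : Finset ℕ), ∀ y : ℝ,
      (1 ≤ y → y ≤ bigP D ^ (0.5 : ℝ) / bigT D → ‖frakv1 c' χ j y‖ ≤ C * bigT D ^ (-c)) ∧
      (bigP D ^ (0.5 : ℝ) < y → y ≤ bigP D ^ (0.502 : ℝ) / bigT D →
        ‖frakv1 c' χ j y - 500 * deriv χ.LFunction 1 / Real.log (bigP D) *
          (-1 - betaJ c' D j * (Real.log (y / bigP D ^ (0.5 : ℝ)) : ℂ))‖ ≤ C * (ell D ^ 15)⁻¹) ∧
      (bigP D ^ (0.502 : ℝ) < y → y ≤ bigP D ^ (0.504 : ℝ) / bigT D →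
        ‖frakv1 c' χ j y - 500 * deriv χ.LFunction 1 / Real.log (bigP D) *
          (1 - betaJ c' D j * (Real.log (bigP D ^ (0.504 : ℝ) / y) : ℂ))‖ ≤ C * (ell D ^ 15)⁻¹) ∧
      ((bigP D ^ (0.5 : ℝ) / bigT D < y ∧ y ≤ bigP D ^ (0.5 : ℝ)) ∨
          (bigP D ^ (0.502 : ℝ) / bigT D < y ∧ y ≤ bigP D ^ (0.502 : ℝ)) ∨
          (bigP D ^ (0.504 : ℝ) / bigT D < y ∧ y < bigP D ^ (0.504 : ℝ)) →
        ‖frakv1 c' χ j y‖ ≤ C * (ell D ^ 7)⁻¹) := by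
  obtain ⟨c, hc, C, h⟩ := lemma101_pow15 hc'
  exact ⟨c, hc, C, Repair.Gap.forAllLarge_assumptionAWith_of_pow15 hE h⟩

end Literature.NumberTheory.LFunctions.Zhang2022.Lemma101
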